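import Mathlib
import Summits.KontsevichZagierPeriods.Zeta5Search.CatalanRemarksTSeries
import Summits.KontsevichZagierPeriods.Zeta5Search.CatalanRemarksTDecay
import Summits.KontsevichZagierPeriods.Zeta5Search.CatalanRemarksTBound
import Summits.KontsevichZagierPeriods.Zeta5Search.CatalanRemarksTReduction
import HarnessLib

/-!
# Zudilin's "remarks" note, Theorem 2 — `ṽ_n/ũ_n → G` and the named fact `remarksTheorem2` as a theorem

Assembly file for the second Apéry-like construction of [Zudilin2002CatalanRemarks, Sect. 2, Theorem 2]
(`Literature.NumberTheory.Irrationality.Zudilin2003.remarksTheorem2`, recursion (13) of the note):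

* `abs_formT_le` — **`|ũ_nG − ṽ_n| ≤ 7·n⁴·4ⁿ`** (`n ≥ 1`): the series (12) `ũ_nG − ṽ_n = −Σ_ν R̃′_n(ν+1)`
  (`remarksTheorem2_series`, `CatalanRemarksTSeries.lean`) dominated term-wise by `8|c̃_n|n²/(ν+1)²`
  (`abs_deriv_RT_le`, `CatalanRemarksTBound.lean`), summed against `ζ(2) = π²/6`, with `|c̃_n| ≤ n²4ⁿ/2`;
* `abs_catalan_sub_approxT_le` — the EFFECTIVE estimate `|G − ṽ_n/ũ_n| ≤ (133/12)·n⁴·(8/19)ⁿ` (`n ≥ 1`),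
  from the bound above and `ũ_n ≥ 6·(19/2)^{n−1}` (`CatalanRemarksTGrowth.lean`, recursion (13));
* `tendsto_approxT_catalan` — **`ṽ_n/ũ_n → G`** (Catalan's constant, the tree's `catalanConstant`);
* `remarksTheorem2_decay` — clause (ii): `|ũ_nG − ṽ_n|^{1/n} → ((√5−1)/2)⁵ = exp(−2.40…)`, and
  `formT_ne_zero` — `ũ_nG − ṽ_n ≠ 0` for every `n`;
* `remarksTheorem2_holds` — **the named Literature fact `Zudilin2003.remarksTheorem2` HOLDS**: all three
  clauses ((ii) decay, (ii′) growth `ũ_n^{1/n} → ((1+√5)/2)⁵` — from `tendsto_log_uT_div`, read off as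
  `remarksTheorem2_holds.2.2.1` —, (iii) the inclusions
  `2^{4n+e}ũ_n ∈ ℤ`, `2^{4n+e}D²_{2n−1}ṽ_n ∈ ℤ` with bounded `e`, here `e ≡ 0`) are now kernel-checked theorems
  (`CatalanRemarksTGrowth`, `CatalanRemarksTDecay`, `CatalanRemarksTBound`, `CatalanRemarksTInclusions`,
  `CatalanRemarksTReduction`).

HONEST FRAMING: systematic search; no irrationality claim unless certified.  Theorem 2 of the note is an
asymptotic statement about ONE explicit sequence of rational approximations to `G`; since the forms decay
like `e^{−2.406n}` while the denominators `2^{4n}D²_{2n−1}` grow like `e^{6.77n}`, it yields NO irrationality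
result for Catalan's constant, and none is claimed.
-/

open Filter Topology Finset Real -- lane edit (P2 g5): `Real` opened for the notation `π` only
open Literature.NumberTheory.Irrationality.Zudilin2003
open Literature.NumberTheory.Transcendental (catalanConstant)
open Summit.KontsevichZagierPeriods.Zeta5Search.Zudilin2003Growth (two_lt_sqrt_five tendsto_root_of_tendsto_log_div)

namespace Summit.KontsevichZagierPeriods.Zeta5Search.CatalanRemarksVT

/-! ### The bound `|ũ_nG − ṽ_n| ≤ 7n⁴4ⁿ` from the series (12) -/

/-- **`|c̃_{k+1}| ≤ (k+1)²4^{k+1}/2`** (`(2n)!/((n−1)!)² = n²·binom(2n,n) ≤ n²4ⁿ`). [folklore] -/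
theorem abs_cRT_le (k : ℕ) : |cRT (k + 1)| ≤ ((k : ℝ) + 1) ^ 2 * 4 ^ (k + 1) / 2 := by
  have hfact : ((2 * (k + 1)).factorial : ℝ) =
      ((2 * (k + 1)).choose (k + 1) : ℝ) * ((k + 1).factorial : ℝ) ^ 2 := by
    have h := Nat.choose_mul_factorial_mul_factorial (show k + 1 ≤ 2 * (k + 1) by omega)
    rw [show 2 * (k + 1) - (k + 1) = k + 1 by omega] at h
    rw [sq, ← mul_assoc]
    exact_mod_cast h.symm
  have hchoose : ((2 * (k + 1)).choose (k + 1) : ℝ) ≤ 4 ^ (k + 1) := by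
    have := Nat.centralBinom_le_four_pow (k + 1)
    rw [Nat.centralBinom_eq_two_mul_choose] at this
    exact_mod_cast this
  have hk1 : ((k + 1).factorial : ℝ) = ((k : ℝ) + 1) * (k.factorial : ℝ) := by
    rw [Nat.factorial_succ]; push_cast; ring
  have hkf : (0 : ℝ) < (k.factorial : ℝ) := by positivity
  have hA : cRT (k + 1) = (-1 : ℝ) ^ (k + 1) *
      (((2 * (k + 1)).choose (k + 1) : ℝ) * ((k : ℝ) + 1) ^ 2 / 2) := by
    unfold cRT
    rw [Nat.add_sub_cancel, hfact, hk1]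
    field_simp
  rw [hA, abs_mul, abs_pow, abs_neg, abs_one, one_pow, one_mul, abs_of_nonneg (by positivity)]
  have hk : (0 : ℝ) ≤ ((k : ℝ) + 1) ^ 2 := by positivity
  nlinarith

/-- **`|ũ_{k+1}G − ṽ_{k+1}| ≤ 8|c̃_{k+1}|(k+1)²·π²/6`** — domination of the series (12) term by term.
[cite: Zudilin2002CatalanRemarks, Sect. 2, Theorem 2, eq. (12)] -/
theorem abs_formT_le_of_series (k : ℕ) :
    |formT (k + 1)| ≤ 8 * |cRT (k + 1)| * ((k : ℝ) + 1) ^ 2 * (π ^ 2 / 6) := by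
  set C := 8 * |cRT (k + 1)| * ((k : ℝ) + 1) ^ 2 with hC
  have hf := remarksTheorem2_series (k + 1) (by omega)
  -- `Σ_{ν≥0} 1/(ν+1)² = π²/6`: Mathlib's `hasSum_zeta_two`, shifted by one.
  have hζ : HasSum (fun ν : ℕ => 1 / ((ν : ℝ) + 1) ^ 2) (π ^ 2 / 6) := by
    have h := (hasSum_nat_add_iff (f := fun n : ℕ => (1 : ℝ) / (n : ℝ) ^ 2) 1).2
      (by simpa using hasSum_zeta_two)
    have e : (fun ν : ℕ => 1 / ((ν : ℝ) + 1) ^ 2) = fun n : ℕ => (1 : ℝ) / (((n + 1 : ℕ) : ℝ)) ^ 2 := by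
      funext ν; push_cast; ring
    rw [e]
    exact h
  have hg : HasSum (fun ν : ℕ => C * (1 / ((ν : ℝ) + 1) ^ 2)) (C * (π ^ 2 / 6)) := hζ.mul_left C
  have hle : ∀ ν : ℕ, |-deriv (fun t : ℝ => RT (k + 1) t) ((ν : ℝ) + 1)| ≤ C * (1 / ((ν : ℝ) + 1) ^ 2) :=
    fun ν => by
      rw [abs_neg, mul_one_div]
      exact abs_deriv_RT_le k ν
  have h1 := hasSum_le (fun ν => (abs_le.1 (hle ν)).2) hf hg
  have h2 := hasSum_le (fun ν => (abs_le.1 (hle ν)).1) hg.neg hf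
  exact abs_le.2 ⟨h2, h1⟩

/-- **MAIN BOUND: `|ũ_nG − ṽ_n| ≤ 7·n⁴·4ⁿ` for `n ≥ 1`.** [cite: Zudilin2002CatalanRemarks, Sect. 2, Theorem 2] -/
theorem abs_formT_le (n : ℕ) (hn : 1 ≤ n) : |formT n| ≤ 7 * (n : ℝ) ^ 4 * 4 ^ n := by
  obtain ⟨k, rfl⟩ : ∃ k, n = k + 1 := ⟨n - 1, by omega⟩
  have h := abs_formT_le_of_series k
  have hc := abs_cRT_le k
  have hpi : π ^ 2 / 6 ≤ 5 / 3 := by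
    have := Real.pi_lt_d2
    nlinarith [Real.pi_pos]
  push_cast
  calc |formT (k + 1)| ≤ 8 * |cRT (k + 1)| * ((k : ℝ) + 1) ^ 2 * (π ^ 2 / 6) := h
    _ ≤ 8 * (((k : ℝ) + 1) ^ 2 * 4 ^ (k + 1) / 2) * ((k : ℝ) + 1) ^ 2 * (5 / 3) := by
        gcongr
    _ = 20 / 3 * ((k : ℝ) + 1) ^ 4 * 4 ^ (k + 1) := by ring
    _ ≤ 7 * ((k : ℝ) + 1) ^ 4 * 4 ^ (k + 1) := by
        have : (0 : ℝ) ≤ ((k : ℝ) + 1) ^ 4 * 4 ^ (k + 1) := by positivity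
        nlinarith

/-! ### The identification `ṽ_n/ũ_n → G` and Theorem 2 -/

/-- `ũ_{k+1} ≥ 6·(19/2)^k` (ratio bracket of `CatalanRemarksTGrowth`). [cite: Zudilin2002CatalanRemarks, Sect. 2, eq. (13)] -/
theorem uTR_succ_ge (k : ℕ) : 6 * (19 / 2 : ℝ) ^ k ≤ uTR (k + 1) := by
  have h := le_of_ratio_lower uTR 1 (by norm_num : (0 : ℝ) ≤ 19 / 2)
    (fun n hn => (ratio_bounds_uT n hn).2.1) k
  have h1 : uTR 1 = 6 := by unfold uTR uT; rw [solT_one]; norm_num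
  rw [h1, add_comm] at h
  exact h

/-- **Effective approximation: `|G − ṽ_{k+1}/ũ_{k+1}| ≤ (133/12)(k+1)⁴(8/19)^{k+1}`.**
[cite: Zudilin2002CatalanRemarks, Sect. 2, Theorem 2] -/
theorem abs_catalan_sub_approxT_le (k : ℕ) :
    |catalanConstant - vTR (k + 1) / uTR (k + 1)| ≤
      133 / 12 * ((k : ℝ) + 1) ^ 4 * (8 / 19 : ℝ) ^ (k + 1) := by
  have hu : 0 < uTR (k + 1) := uTR_pos (k + 1) (by omega)
  have hid : catalanConstant - vTR (k + 1) / uTR (k + 1) = formT (k + 1) / uTR (k + 1) := by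
    rw [formT_eq]; field_simp
  rw [hid, abs_div, abs_of_pos hu, div_le_iff₀ hu]
  have hf := abs_formT_le (k + 1) (by omega)
  push_cast at hf
  have hug := uTR_succ_ge k
  have h4 : (8 / 19 : ℝ) ^ k * (19 / 2) ^ k = 4 ^ k := by rw [← mul_pow]; norm_num
  have key : 7 * ((k : ℝ) + 1) ^ 4 * 4 ^ (k + 1) =
      133 / 12 * ((k : ℝ) + 1) ^ 4 * (8 / 19 : ℝ) ^ (k + 1) * (6 * (19 / 2 : ℝ) ^ k) := by
    rw [pow_succ (4 : ℝ) k, pow_succ (8 / 19 : ℝ) k, ← h4]; ring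
  calc |formT (k + 1)| ≤ 7 * ((k : ℝ) + 1) ^ 4 * 4 ^ (k + 1) := hf
    _ = 133 / 12 * ((k : ℝ) + 1) ^ 4 * (8 / 19 : ℝ) ^ (k + 1) * (6 * (19 / 2 : ℝ) ^ k) := key
    _ ≤ 133 / 12 * ((k : ℝ) + 1) ^ 4 * (8 / 19 : ℝ) ^ (k + 1) * uTR (k + 1) :=
        mul_le_mul_of_nonneg_left hug (by positivity)

/-- **IDENTIFICATION OF THE LIMIT: `ṽ_n/ũ_n → G`.** [cite: Zudilin2002CatalanRemarks, Sect. 2, Theorem 2] -/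
theorem tendsto_approxT_catalan : Tendsto (fun n : ℕ => vTR n / uTR n) atTop (𝓝 catalanConstant) := by
  have h0 : Tendsto (fun k : ℕ => ((k : ℝ) + 1) ^ 4 * (8 / 19 : ℝ) ^ (k + 1)) atTop (𝓝 0) := by
    have h := tendsto_pow_const_mul_const_pow_of_abs_lt_one 4
      (show |(8 / 19 : ℝ)| < 1 by rw [abs_of_pos (by norm_num)]; norm_num)
    have h' := (tendsto_add_atTop_iff_nat (f := fun n : ℕ => (n : ℝ) ^ 4 * (8 / 19 : ℝ) ^ n) 1).2 h
    refine h'.congr fun k => ?_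
    push_cast
    ring
  have h1 : Tendsto (fun k : ℕ => 133 / 12 * (((k : ℝ) + 1) ^ 4 * (8 / 19 : ℝ) ^ (k + 1))) atTop (𝓝 0) := by
    simpa using h0.const_mul (133 / 12 : ℝ)
  have h2 : Tendsto (fun k : ℕ => catalanConstant - vTR (k + 1) / uTR (k + 1)) atTop (𝓝 0) :=
    squeeze_zero_norm (fun k => by rw [Real.norm_eq_abs, ← mul_assoc]; exact abs_catalan_sub_approxT_le k) h1
  have h3 : Tendsto (fun k : ℕ => vTR (k + 1) / uTR (k + 1)) atTop (𝓝 catalanConstant) := by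
    have := (tendsto_const_nhds : Tendsto (fun _ : ℕ => catalanConstant) atTop (𝓝 catalanConstant)).sub h2
    simpa using this
  exact (tendsto_add_atTop_iff_nat (f := fun n : ℕ => vTR n / uTR n) 1).1 h3

/-- The approximants `r̃_n = ṽ_n/ũ_n` of `CatalanRemarksTDecay` converge to `G`. [cite: Zudilin2002CatalanRemarks, Sect. 2, Theorem 2] -/
theorem tendsto_approxT : Tendsto approxT atTop (𝓝 catalanConstant) := tendsto_approxT_catalan

/-- **Clause (ii) of Theorem 2: `|ũ_nG − ṽ_n|^{1/n} → ((√5−1)/2)⁵`.** [cite: Zudilin2002CatalanRemarks, Sect. 2, Theorem 2] -/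
theorem remarksTheorem2_decay :
    Tendsto (fun n : ℕ => |formT n| ^ (1 / (n : ℝ))) atTop (𝓝 (((Real.sqrt 5 - 1) / 2) ^ 5)) :=
  remarksTheorem2_decay_of_tendsto tendsto_approxT_catalan

/-- `ũ_nG − ṽ_n ≠ 0` for every `n`. [cite: Zudilin2002CatalanRemarks, Sect. 2, Theorem 2] -/
theorem formT_ne_zero (n : ℕ) : formT n ≠ 0 := formT_ne_zero_of_tendsto_catalan tendsto_approxT_catalan n

/-- **THE NAMED FACT `Zudilin2003.remarksTheorem2` ([Zu02c, Sect. 2, Theorem 2]) HOLDS.**  Clause (ii) is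
`remarksTheorem2_decay`; clause (ii′) `ũ_n^{1/n} → ((1+√5)/2)⁵` is assembled right here from the exact rate
`log ũ_n / n → log ((1+√5)/2)⁵` (`tendsto_log_uT_div`, `CatalanRemarksTGrowth`) and positivity (`uTR_pos`) by
`Zudilin2003Growth.tendsto_root_of_tendsto_log_div` — read it off as `remarksTheorem2_holds.2.2.1`; clauses (i),
(iii) enter through `remarksTheorem2_of_limits`. [cite: Zudilin2002CatalanRemarks, Sect. 2, Theorem 2] -/
theorem remarksTheorem2_holds : remarksTheorem2 := by
  have hl0 : (0 : ℝ) < ((1 + Real.sqrt 5) / 2) ^ 5 := by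
    have := two_lt_sqrt_five; positivity
  exact remarksTheorem2_of_limits remarksTheorem2_decay
    (tendsto_root_of_tendsto_log_div (fun n => ((uT n : ℚ) : ℝ)) hl0 (fun n hn => uTR_pos n hn)
      tendsto_log_uT_div)

end Summit.KontsevichZagierPeriods.Zeta5Search.CatalanRemarksVT
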